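import Literature.NumberTheory.LFunctions.NoRealZeroCertificateReplayTableB
import Literature.NumberTheory.LFunctions.NoRealZeroCertificateReplayTable16A
import Literature.NumberTheory.LFunctions.NoRealZeroCertificateReplayTable16B
import Literature.NumberTheory.LFunctions.NoRealZeroCertificateReplayFast
import HarnessLib

/-!
# Kernel replay of the Lu–Zaman–Zhao certificates: the verified prime table for `p < 2^16`

Topic `Literature/NumberTheory/LFunctions`. Assembly of the kernel-verified prime tables:
`table16 = table16A ++ table16B` (the 3030 primes `2^15 < p < 2^16`, parts verified entrywise in
`NoRealZeroCertificateReplayTable16A/B.lean`), its sortedness (`table16_sorted`, one kernel pass) and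
validity (`table16_valid`), and **`table15_16 = table15 ++ table16`** — all 6542 primes `p < 2^16` —
with **`table15_16_valid : TableValid table15_16`** (junction by the separating bound `2^15`,
`TableValid.append_of_bound`, the two bound checks by `decide`). This is the table of the first
HEAVY tier of the replay (the fundamental discriminants whose Table-1 certificate at `λ = 1.6`,
`c = 1/5` needs primes in `(2^15, 2^16)`: 30 557 of the 72 088 heavy discriminants of
`(23, 4·10⁵]`, Lu–Zaman–Zhao arXiv:2602.03626 §3), used by the `…ReplayHeavy16_*` files through the
row-list checker `checkListK` (`NoRealZeroCertificateReplayFast.lean`). Also the bookkeeping lemma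
`forall_rowsDK_append` with which those files join their row lists.

## References

* W. Lu, A. Zaman, K. Zhao, *Dirichlet L-functions of quadratic characters have no exceptional
  zeros for moduli up to 10¹⁰*, Math. Comp. (2026), arXiv:2602.03626, §2.2–§3. [LuZamanZhao2026]
-/

namespace Literature.NumberTheory.LFunctions
namespace LuZamanZhao2026
namespace Replay

/-- **The verified prime table for `2^15 < p < 2^16`** (3030 primes): `table16 = table16A ++ table16B`. [folklore] -/
def table16 : List PRow :=
  table16A ++ table16B

set_option maxHeartbeats 0 in
/-- The primes of `table16` increase strictly. [cite: LuZamanZhao2026, §2.2 and (2.3)] -/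
theorem table16_sorted : sortedCheck table16 = true := by
  decide +kernel

/-- **`table16` is a valid table.** [cite: LuZamanZhao2026, §2.2 and (2.3)] -/
theorem table16_valid : TableValid table16 :=
  tableValid_of (entryValid_append table16A_entryValid table16B_entryValid) table16_sorted

/-- **The verified prime table for `p < 2^16`** (6542 primes): `table15_16 = table15 ++ table16`. [folklore] -/
def table15_16 : List PRow :=
  table15 ++ table16

set_option maxHeartbeats 0 in
/-- Every prime of `table15` is `< 2^15`. [cite: LuZamanZhao2026, §2.2 and (2.3)] -/
theorem table15_allPLt : allPLt table15 32768 = true := by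
  decide +kernel

set_option maxHeartbeats 0 in
/-- Every prime of `table16` is `≥ 2^15`. [cite: LuZamanZhao2026, §2.2 and (2.3)] -/
theorem table16_allPGe : allPGe table16 32768 = true := by
  decide +kernel

/-- **`table15_16` is a valid table** — the hypothesis of `certifiedAt_of_checkListK` /
`certifiedRange_of_checkRange2` for the first heavy tier. [cite: LuZamanZhao2026, §2.2 and (2.3)] -/
theorem table15_16_valid : TableValid table15_16 :=
  table15_valid.append_of_bound table16_valid 32768 table15_allPLt table16_allPGe

/-- Joining row-list certificates: from the certificates of two row lists to those of their
concatenation. [cite: LuZamanZhao2026, §2.1–§3] -/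
theorem forall_rowsDK_append {c : ℝ} {r₁ r₂ : List (Bool × ℕ)}
    (h₁ : ∀ D ∈ rowsDK r₁, CertifiedAt c D) (h₂ : ∀ D ∈ rowsDK r₂, CertifiedAt c D) :
    ∀ D ∈ rowsDK (r₁ ++ r₂), CertifiedAt c D := by
  intro D hD
  rw [rowsDK, List.map_append, List.mem_append] at hD
  rcases hD with h | h
  · exact h₁ D h
  · exact h₂ D h

end Replay
end LuZamanZhao2026
end Literature.NumberTheory.LFunctions
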